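import Mathlib
import Literature.NumberTheory.Automorphic.HilbertModularFormQExpansion

/-!
# Products of encoded `q`-expansions encode the cone convolution

Stub `stub_encoded_mul` (O4) for line Sketch-ideate-r1-k1 of the crux
`HilbertIntegralOverconvergentIsCongruence` (stmt-Langlands-8485), Section O (the `q`-expansion
dictionary feeding the `d`-free algebraization engine over `MvPowerSeries (Fin d)`).  Coefficient
functions `a : F → R` on the cone `qIndexSet F` of `q`-expansion indices are transported to
`MvPowerSeries (Fin d) R` along an encoding `idx : F → ℕ^d` which is injective and additive ON THE
CONE; "`A` encodes `a`" means `coeff (idx μ) A = a μ` on the cone and `coeff n A = 0` off the image of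
the cone.  We show: the product `A * B` of two encodings encodes the cone convolution
`ν ↦ ∑_{μ₁ + μ₂ = ν} a μ₁ · b μ₂` and vanishes off the image of the cone.
Proof: `coeff n (A * B) = ∑_{(p₁, p₂) ∈ antidiagonal n} coeff p₁ A · coeff p₂ B`
(`MvPowerSeries.coeff_mul`); a summand survives only if `p₁ = idx μ₁`, `p₂ = idx μ₂` with `μ₁, μ₂` in
the cone (`emu_summand_eq_zero`), and then `n = idx (μ₁ + μ₂)` with `μ₁ + μ₂` in the cone (the cone is
closed under addition, `emu_add_mem_qIndexSet`).  For `n = idx ν` injectivity on the cone gives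
`μ₁ + μ₂ = ν`, and `Finset.sum_of_injOn` along `μ ↦ (idx μ.1, idx μ.2)` identifies the two sums.
-/

set_option linter.dupNamespace false

noncomputable section

namespace Summit.Langlands.Langlands.Theorems.HilbertIntegralOverconvergentIsCongruence

open NumberField
open Literature.NumberTheory.Automorphic Literature.NumberTheory.Automorphic.HilbertModular

/-- The cone `qIndexSet F` of `q`-expansion indices (`ν` in the dual lattice with `ν = 0` or `ν`
totally positive) is closed under addition. -/
theorem emu_add_mem_qIndexSet {F : Type} [Field F] [NumberField F] {μ μ' : F}
    (hμ : μ ∈ qIndexSet F) (hμ' : μ' ∈ qIndexSet F) : μ + μ' ∈ qIndexSet F := by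
  rw [mem_qIndexSet_iff] at hμ hμ' ⊢
  refine ⟨fun a ↦ ?_, ?_⟩
  · obtain ⟨n, hn⟩ := hμ.1 a
    obtain ⟨n', hn'⟩ := hμ'.1 a
    exact ⟨n + n', by rw [add_mul, map_add, hn, hn', Int.cast_add]⟩
  · rcases hμ.2 with rfl | hpos
    · rw [zero_add]
      exact hμ'.2
    · rcases hμ'.2 with rfl | hpos'
      · rw [add_zero]
        exact Or.inr hpos
      · exact Or.inr fun σ ↦ by rw [map_add]; exact add_pos (hpos σ) (hpos' σ)

/-- A summand `coeff p₁ A · coeff p₂ B` of the product formula, for `A`, `B` vanishing off the image of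
the cone under `idx`, is zero unless both `p₁` and `p₂` are encoded cone indices. -/
theorem emu_summand_eq_zero {F : Type} [Field F] [NumberField F] {d : ℕ} (idx : F → (Fin d →₀ ℕ))
    {R : Type} [CommRing R] (A B : MvPowerSeries (Fin d) R)
    (hA0 : ∀ n, (∀ μ ∈ qIndexSet F, idx μ ≠ n) → MvPowerSeries.coeff n A = 0)
    (hB0 : ∀ n, (∀ μ ∈ qIndexSet F, idx μ ≠ n) → MvPowerSeries.coeff n B = 0)
    (p : (Fin d →₀ ℕ) × (Fin d →₀ ℕ))
    (hp : ∀ μ₁ ∈ qIndexSet F, ∀ μ₂ ∈ qIndexSet F, idx μ₁ = p.1 → idx μ₂ ≠ p.2) :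
    MvPowerSeries.coeff p.1 A * MvPowerSeries.coeff p.2 B = 0 := by
  by_cases h1 : ∃ μ₁ ∈ qIndexSet F, idx μ₁ = p.1
  · obtain ⟨μ₁, hμ₁, h₁⟩ := h1
    rw [hB0 p.2 fun μ₂ hμ₂ ↦ hp μ₁ hμ₁ μ₂ hμ₂ h₁, mul_zero]
  · rw [hA0 p.1 fun μ₁ hμ₁ h₁ ↦ h1 ⟨μ₁, hμ₁, h₁⟩, zero_mul]

/-- **stub O4 — `stub_encoded_mul`.** Under an encoding of the cone of `q`-indices into `ℕ^d`
(injective, additive on the cone), the `MvPowerSeries` product of two encoded coefficient functions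
encodes their cone convolution, and vanishes off the image of the cone (the `MvPowerSeries`
antidiagonal of an encoded index meets the images exactly in the encoded cone antidiagonal).
[folklore] -/
theorem stub_encoded_mul (F : Type) [Field F] [NumberField F] {d : ℕ} (idx : F → (Fin d →₀ ℕ))
    (hinj : Set.InjOn idx (qIndexSet F))
    (hadd : ∀ μ ∈ qIndexSet F, ∀ μ' ∈ qIndexSet F, idx (μ + μ') = idx μ + idx μ')
    (R : Type) [CommRing R] (a b : F → R) (A B : MvPowerSeries (Fin d) R)
    (hA : ∀ μ ∈ qIndexSet F, MvPowerSeries.coeff (idx μ) A = a μ)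
    (hA0 : ∀ n, (∀ μ ∈ qIndexSet F, idx μ ≠ n) → MvPowerSeries.coeff n A = 0)
    (hB : ∀ μ ∈ qIndexSet F, MvPowerSeries.coeff (idx μ) B = b μ)
    (hB0 : ∀ n, (∀ μ ∈ qIndexSet F, idx μ ≠ n) → MvPowerSeries.coeff n B = 0) :
    (∀ ν ∈ qIndexSet F, ∀ T : Finset (F × F),
        (∀ μ : F × F, μ ∈ T ↔ μ.1 ∈ qIndexSet F ∧ μ.2 ∈ qIndexSet F ∧ μ.1 + μ.2 = ν) →
        MvPowerSeries.coeff (idx ν) (A * B) = ∑ μ ∈ T, a μ.1 * b μ.2) ∧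
      ∀ n, (∀ μ ∈ qIndexSet F, idx μ ≠ n) → MvPowerSeries.coeff n (A * B) = 0 := by
  refine ⟨fun ν hν T hT ↦ ?_, fun n hn ↦ ?_⟩
  · rw [MvPowerSeries.coeff_mul]
    symm
    refine Finset.sum_of_injOn (fun μ : F × F ↦ (idx μ.1, idx μ.2)) ?_ ?_ ?_ ?_
    · -- the encoding is injective on `T` (componentwise injectivity on the cone)
      intro μ hμ μ' hμ' h
      have hμT := (hT μ).1 (Finset.mem_coe.1 hμ)
      have hμ'T := (hT μ').1 (Finset.mem_coe.1 hμ')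
      simp only [Prod.mk.injEq] at h
      exact Prod.ext (hinj hμT.1 hμ'T.1 h.1) (hinj hμT.2.1 hμ'T.2.1 h.2)
    · -- it maps `T` into the antidiagonal of `idx ν` (additivity on the cone)
      intro μ hμ
      have hμT := (hT μ).1 (Finset.mem_coe.1 hμ)
      simp only [Finset.mem_coe, Finset.HasAntidiagonal.mem_antidiagonal]
      rw [← hadd μ.1 hμT.1 μ.2 hμT.2.1, hμT.2.2]
    · -- summands off the image of `T` vanish
      intro p hp hpim
      refine emu_summand_eq_zero idx A B hA0 hB0 p fun μ₁ hμ₁ μ₂ hμ₂ h₁ h₂ ↦ hpim ?_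
      have hμν : μ₁ + μ₂ = ν := by
        refine hinj (emu_add_mem_qIndexSet hμ₁ hμ₂) hν ?_
        rw [hadd μ₁ hμ₁ μ₂ hμ₂, h₁, h₂]
        exact Finset.HasAntidiagonal.mem_antidiagonal.1 hp
      exact ⟨(μ₁, μ₂), Finset.mem_coe.2 ((hT (μ₁, μ₂)).2 ⟨hμ₁, hμ₂, hμν⟩), Prod.ext h₁ h₂⟩
    · -- on `T` the summands are `a μ.1 * b μ.2`
      intro μ hμ
      have hμT := (hT μ).1 hμ
      change a μ.1 * b μ.2 = MvPowerSeries.coeff (idx μ.1) A * MvPowerSeries.coeff (idx μ.2) B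
      rw [hA μ.1 hμT.1, hB μ.2 hμT.2.1]
  · rw [MvPowerSeries.coeff_mul]
    refine Finset.sum_eq_zero fun p hp ↦ emu_summand_eq_zero idx A B hA0 hB0 p ?_
    intro μ₁ hμ₁ μ₂ hμ₂ h₁ h₂
    refine hn (μ₁ + μ₂) (emu_add_mem_qIndexSet hμ₁ hμ₂) ?_
    rw [hadd μ₁ hμ₁ μ₂ hμ₂, h₁, h₂]
    exact Finset.HasAntidiagonal.mem_antidiagonal.1 hp

end Summit.Langlands.Langlands.Theorems.HilbertIntegralOverconvergentIsCongruence
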